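import Summits.BirchSwinnertonDyer.Rank1Residual.Additive.BudgetFromRationalClasses
import Literature.NumberTheory.EllipticCurves.IwasawaEulerCharDualityProofs
import Literature.NumberTheory.EllipticCurves.IwasawaAlgebraPseudoNullProofs
import HarnessLib

/-!
# Route M's generator COUNT from level-`0` classes, I: `#t ≤ #(X/𝔪X)` for every finite family `t`
# of `p`-torsion `Γ`-fixed classes of `Sel_{p^∞}(E/K_∞)`, and for every finite `t ⊆ A_0[p]` when
# `E(K)[p] = 0` (cell `b2b-bsdres`, unit `b2b-bsdres-eisenstein-p1`, gen 15; FILE 1 of 2)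

HONEST FRAMING (run/shared/lean/b2b/bsd-rank1-residual/, verbatim in every file): the goal of the
cell is to DELETE the COMBINATION-SHAPED residual classes of the Birch–Swinnerton-Dyer formula for
ALL analytic-rank `≤ 1` elliptic curves over `ℚ` — "full BSD formula for every rank `≤ 1` curve in
class `C`" assembled STRICTLY from published theorems — so that the rank-`≤ 1` remainder becomes
exactly the CONSTRUCTION-SHAPED classes, which are TYPED (missing-input `Prop`s), NOT attempted.
This is not "finishing BSD". Sub-cell `b2b-bsdres-eisenstein-p1` (CLASS-OWNERS row "X1 (r = 0)"):
research route; NO CLAIM BEYOND STATED CLASSES; nothing here changes a label; nothing is booked.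
THEOREMS ONLY — no definition, no named fact, no typed input introduced, nothing about any
particular curve asserted.

## What and why

Route M (X1R0-GAPMAP §21–§22; `X1/GeneratorSqueeze.lean`; LEMMA M₀ `#(X/𝔪X) ≤ p^{v_p(f_E(0))}` =
`X1/GeneratorBound.lean`; `X1/GeneratorCountSqueeze.lean`) closes a leaf class from a LOWER bound on
the number of generators of `X = X(E/ℚ_∞)`: the typed per-pair input `GeneratorCountGE W p B` =
"`p^B ≤ #(X/𝔪X)` for every torsion cyclotomic dual datum", certified outside the kernel as route T's
count `B = t₀ + a − 2δ` (GAPMAP §14.1). This file proves the GLOBAL, duality half of such a count,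
for an elliptic curve `E = W` over a number field `K`, ANY `ℤ_p`-extension `κ`, any `γ ∈ Γ_K` and
any Pontryagin-dual datum `D` (`X = D.X`) of `IwasawaSelmer`:

* §1 `toDual_smul_apply_eq`: for `s ∈ Sel_∞` with `p•s = 0` and `conj_γ s = s` and any `r ∈ Λ`,
  `toDual (r•x) s = (r(0) mod p) • toDual x s` (from the two identities `toDual_T_smul` — `T` acts
  as `conj_γ − 1` — and `toDual_C_smul` of `SelmerDualData`, and `r = X·r' + C(r(0))`); so `𝔪X`
  pairs to zero with `s` (`toDual_apply_eq_zero_of_mem_maximalIdeal_smul_top`;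
  `𝔪 = ker(Λ → ℤ_p → ℤ/p)`), each such `s` defines a character `x mod 𝔪X ↦ toDual x s` of `X/𝔪X`,
  and distinct classes give distinct characters (`eq_of_forall_toDual_apply_eq`: `toDual` is onto
  `Hom(Sel_∞, ℚ/ℤ)` and characters separate points, Mathlib
  `CharacterModule.eq_zero_of_character_apply`); hence
  **`card_le_natCard_quotient_maximalIdeal`: a finite family of distinct `p`-torsion `γ`-fixed
  classes has at most `#(X/𝔪X)` members** when `X` is finitely generated (`#Hom(Q, ℚ/ℤ) = #Q` for
  the finite group `Q = X/𝔪X`, tree `PontryaginCard.natCard_characterModule_of_finite`). This is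
  the counting half of "`X/𝔪X` is dual to `Sel_E(F_∞)_p[𝔪]`" (Greenberg, LNM 1716, §1 p. 60; the
  tree's Nakayama file `IwasawaNakayamaProofs` uses the same pieces `S_1`, `X⁽¹⁾`).
* §2: when `E(K)[p] = 0` the restriction `h_0 : H¹(K, E[p^∞]) → H¹(K_∞, E[p^∞])` is injective
  (n1011's `Additive.layerToInfty_injective_of_no_pTorsion`, Greenberg Lemma 3.1) and carries
  `A_0 = h_0⁻¹(Sel_∞)` (`selmerInftyPreimage κ 0`, Greenberg's `ker g_0 = A_0/Sel_0`, §3 p. 85) into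
  the `Γ`-fixed classes (`range_layerToInfty_le_layerInvariants_holds`, `κ.layerSubgroup 0 = ⊤`):
  **`card_le_natCard_quotient_maximalIdeal_of_layerZeroClasses`: `#t ≤ #(X/𝔪X)` for every finite
  `t ⊆ A_0[p]`.**

FILE 2 (`X1/GeneratorCountTamagawa.lean`) specialises to `ℚ`: `GeneratorCountGE W p b` from `p^b`
classes of `A_0[p]`, and from the tree's Tamagawa witnesses (n1011's Poitou–Tate budget door).

References: [GreenbergLNM1716] §1 p. 60 (X/𝔪X, Nakayama), Thm. 1.2, §3 pp. 85–86 (A_n, Lemma 3.1),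
§4 p. 137; [Lang1990] Ch. 5 §1; X1R0-GAPMAP §14.1, §21, §22, §24.
-/

noncomputable section

open scoped Classical

open WeierstrassCurve Literature.NumberTheory.EllipticCurves
  Literature.NumberTheory.EllipticCurves.IwasawaAlgebra IsLocalRing

set_option autoImplicit false

universe u

namespace Summit.BirchSwinnertonDyer.Rank1Residual.X1.GeneratorCountLayerZero

/-! ## §1. Pontryagin pairing: `p`-torsion `γ`-fixed classes of `Sel_∞` are counted by `X/𝔪X` -/

section Pairing

variable {K : Type u} [Field K] [NumberField K] {W : WeierstrassCurve K} {p : ℕ} [hp : Fact p.Prime]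
  {κ : ZpExtension K p} {γ : Field.absoluteGaloisGroup K} (D : W.SelmerDualData κ γ)

/-- The maximal ideal `𝔪` of `Λ = ℤ_p⟦T⟧` consists of the power series whose constant coefficient
is divisible by `p` (`𝔪` is the kernel of `Λ → ℤ_p → ℤ/p`). [folklore] -/
theorem toZModPow_one_constantCoeff_eq_zero_of_mem_maximalIdeal {r : IwasawaAlgebra p}
    (hr : r ∈ maximalIdeal (IwasawaAlgebra p)) :
    PadicInt.toZModPow 1 (PowerSeries.constantCoeff r) = 0 := by
  let g : IwasawaAlgebra p →+* ZMod p :=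
    (PadicInt.toZMod (p := p)).comp (PowerSeries.constantCoeff (R := ℤ_[p]))
  have hg : Function.Surjective g := ZMod.ringHom_surjective g
  have hker : RingHom.ker g = maximalIdeal (IwasawaAlgebra p) :=
    IsLocalRing.eq_maximalIdeal (RingHom.ker_isMaximal_of_surjective g hg)
  rw [← hker, RingHom.mem_ker] at hr
  have h1 : PowerSeries.constantCoeff r ∈ RingHom.ker (PadicInt.toZMod (p := p)) := hr
  rw [PadicInt.ker_toZMod, PadicInt.maximalIdeal_eq_span_p] at h1
  have h2 : PowerSeries.constantCoeff r ∈ RingHom.ker (PadicInt.toZModPow (p := p) 1) := by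
    rw [PadicInt.ker_toZModPow, pow_one]; exact h1
  exact h2

/-- **The pairing identity**: for `s ∈ Sel_∞` with `p•s = 0` and `conj_γ s = s`, and any `r ∈ Λ`,
`toDual (r•x) s = (r(0) mod p) • toDual x s` — `T` acts as `conj_γ − 1` (kills `s`) and constants
act through `ℤ_p → ℤ/p` on `p`-torsion classes. [folklore] -/
theorem toDual_smul_apply_eq (r : IwasawaAlgebra p) (x : D.X) (s : W.selmerInfty κ)
    (hps : p • s = 0)
    (hγs : W.conjH1 p κ.kerSubgroup γ (s : W.subgroupH1 p κ.kerSubgroup) = s) :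
    D.toDual (r • x) s =
      (PadicInt.toZModPow 1 (PowerSeries.constantCoeff r)).val • D.toDual x s := by
  have hdec := PowerSeries.eq_X_mul_shift_add_const r
  set r' : IwasawaAlgebra p := PowerSeries.mk fun n ↦ PowerSeries.coeff (n + 1) r with hr'
  have hT : D.toDual ((PowerSeries.X : IwasawaAlgebra p) • (r' • x)) s = 0 := by
    rw [D.toDual_T_smul]
    have : (⟨W.conjH1 p κ.kerSubgroup γ (s : W.subgroupH1 p κ.kerSubgroup),
        D.conj_mem s s.2⟩ : W.selmerInfty κ) = s := Subtype.ext hγs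
    rw [this, sub_self]
  have hC : D.toDual (PowerSeries.C (PowerSeries.constantCoeff r) • x) s =
      (PadicInt.toZModPow 1 (PowerSeries.constantCoeff r)).val • D.toDual x s :=
    D.toDual_C_smul _ x s 1 (by rw [pow_one]; exact hps)
  calc D.toDual (r • x) s
      = D.toDual (((PowerSeries.X : IwasawaAlgebra p) * r' +
          PowerSeries.C (PowerSeries.constantCoeff r)) • x) s := by rw [← hdec]
    _ = D.toDual ((PowerSeries.X : IwasawaAlgebra p) • (r' • x)) s +
          D.toDual (PowerSeries.C (PowerSeries.constantCoeff r) • x) s := by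
        rw [add_smul, mul_smul, map_add, AddMonoidHom.add_apply]
    _ = (PadicInt.toZModPow 1 (PowerSeries.constantCoeff r)).val • D.toDual x s := by
        rw [hT, hC, zero_add]

/-- For `r ∈ 𝔪` the pairing with a `p`-torsion `γ`-fixed class vanishes: `toDual (r•x) s = 0`.
[folklore] -/
theorem toDual_smul_apply_eq_zero_of_mem_maximalIdeal {r : IwasawaAlgebra p}
    (hr : r ∈ maximalIdeal (IwasawaAlgebra p)) (x : D.X) (s : W.selmerInfty κ) (hps : p • s = 0)
    (hγs : W.conjH1 p κ.kerSubgroup γ (s : W.subgroupH1 p κ.kerSubgroup) = s) :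
    D.toDual (r • x) s = 0 := by
  rw [toDual_smul_apply_eq D r x s hps hγs,
    toZModPow_one_constantCoeff_eq_zero_of_mem_maximalIdeal hr, ZMod.val_zero, zero_smul]

/-- **`𝔪X` pairs to zero with every `p`-torsion `γ`-fixed class**: `toDual x s = 0` for all
`x ∈ 𝔪X` (`Submodule.smul_induction_on` over the previous lemma). [folklore] -/
theorem toDual_apply_eq_zero_of_mem_maximalIdeal_smul_top {x : D.X}
    (hx : x ∈ maximalIdeal (IwasawaAlgebra p) • (⊤ : Submodule (IwasawaAlgebra p) D.X))
    (s : W.selmerInfty κ) (hps : p • s = 0)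
    (hγs : W.conjH1 p κ.kerSubgroup γ (s : W.subgroupH1 p κ.kerSubgroup) = s) :
    D.toDual x s = 0 := by
  refine Submodule.smul_induction_on hx (fun r hr y _ ↦ ?_) (fun y z hy hz ↦ ?_)
  · exact toDual_smul_apply_eq_zero_of_mem_maximalIdeal D hr y s hps hγs
  · rw [map_add, AddMonoidHom.add_apply, hy, hz, add_zero]

/-- **Characters separate the classes**: if two `p`-torsion classes `s, s'` of `Sel_∞` have
`toDual x s = toDual x s'` for all `x ∈ X`, then `s = s'` (`toDual` is onto `Hom(Sel_∞, ℚ/ℤ)` and the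
characters of `Sel_∞` separate points, Mathlib `CharacterModule.eq_zero_of_character_apply`).
[folklore] -/
theorem eq_of_forall_toDual_apply_eq {s s' : W.selmerInfty κ}
    (h : ∀ x : D.X, D.toDual x s = D.toDual x s') : s = s' := by
  rw [← sub_eq_zero]
  apply CharacterModule.eq_zero_of_character_apply (A := W.selmerInfty κ)
  intro χ
  obtain ⟨x, rfl⟩ := (D.bijective).2 χ
  change D.toDual x (s - s') = 0
  rw [map_sub, h x, sub_self]

/-- **`#{p`-torsion `γ`-fixed classes} ≤ #(X/𝔪X)`**: a finite family of DISTINCT classes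
`s ∈ Sel_{p^∞}(E/K_∞)` with `p•s = 0` and `conj_γ s = s` has at most `#(X/𝔪X)` members, for EVERY
Pontryagin-dual datum `D` with `X = D.X` finitely generated (then `X/𝔪X` is finite): `s ↦` the
character `x mod 𝔪X ↦ toDual x s` of the finite group `X/𝔪X` is injective, and
`#Hom(X/𝔪X, ℚ/ℤ) = #(X/𝔪X)` (tree `PontryaginCard.natCard_characterModule_of_finite`). This is the
half of the duality `X/𝔪X ≅ Hom(Sel_∞[𝔪], ℚ/ℤ)` (Greenberg LNM 1716 p. 60) that a COUNT needs.
[cite: GreenbergLNM1716, §1 p. 60 (X/𝔪X dual to Sel_∞[p]^Γ)] -/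
theorem card_le_natCard_quotient_maximalIdeal [Module.Finite (IwasawaAlgebra p) D.X]
    (t : Finset (W.selmerInfty κ))
    (ht : ∀ s ∈ t, p • s = 0 ∧ W.conjH1 p κ.kerSubgroup γ (s : W.subgroupH1 p κ.kerSubgroup) = s) :
    t.card ≤ Nat.card (D.X ⧸ maximalIdeal (IwasawaAlgebra p) •
      (⊤ : Submodule (IwasawaAlgebra p) D.X)) := by
  set Q := D.X ⧸ maximalIdeal (IwasawaAlgebra p) • (⊤ : Submodule (IwasawaAlgebra p) D.X) with hQ
  haveI : Finite Q := by
    haveI := finite_quotient_maximalIdeal p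
    exact Module.finite_of_finite (IwasawaAlgebra p ⧸ maximalIdeal (IwasawaAlgebra p)) (M := Q)
  haveI : Finite (CharacterModule Q) := PontryaginCard.finite_characterModule_of_finite Q
  -- the character of `X/𝔪X` attached to a class `s ∈ t`: `x mod 𝔪X ↦ toDual x s`
  let f : t → CharacterModule Q := fun s ↦
    QuotientAddGroup.lift ((maximalIdeal (IwasawaAlgebra p) •
        (⊤ : Submodule (IwasawaAlgebra p) D.X)).toAddSubgroup) (D.toDual.flip s.1) fun x hx ↦ by
      simpa using toDual_apply_eq_zero_of_mem_maximalIdeal_smul_top D hx s.1 (ht s.1 s.2).1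
        (ht s.1 s.2).2
  have hf_mk : ∀ (s : t) (x : D.X), f s (Submodule.Quotient.mk x) = D.toDual x s.1 := fun _ _ ↦ rfl
  have hf : Function.Injective f := by
    rintro ⟨s, hs⟩ ⟨s', hs'⟩ h
    refine Subtype.ext (eq_of_forall_toDual_apply_eq D fun x ↦ ?_)
    rw [← hf_mk ⟨s, hs⟩ x, ← hf_mk ⟨s', hs'⟩ x, h]
  calc t.card = Nat.card t := (Nat.card_eq_finsetCard t).symm
    _ ≤ Nat.card (CharacterModule Q) := Nat.card_le_card_of_injective f hf
    _ = Nat.card Q := PontryaginCard.natCard_characterModule_of_finite Q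

end Pairing

/-! ## §2. Level-`0` classes: `#A_0[p]`-families are counted by `X/𝔪X` when `E(K)[p] = 0` -/

section LayerZero

variable {K : Type u} [Field K] [NumberField K] (W : WeierstrassCurve K) {p : ℕ}
  [hp : Fact p.Prime] (κ : ZpExtension K p) {γ : Field.absoluteGaloisGroup K}
  (D : W.SelmerDualData κ γ)

/-- **`#A_0[p]`-families are counted by `X/𝔪X`.** For an elliptic curve `E = W` over a number field
`K` with `E(K)[p] = 0`, ANY `ℤ_p`-extension `κ`, any `γ ∈ Γ_K` and any Pontryagin-dual datum `D`
with `X = D.X` finitely generated: a finite family `t` of DISTINCT `p`-torsion classes of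
`A_0 = h_0⁻¹(Sel_{p^∞}(E/K_∞))` (`selmerInftyPreimage κ 0`; Greenberg's `ker g_0 = A_0/Sel_0`, LNM
1716 §3 p. 85) has `#t ≤ #(X/𝔪X)`: the classes `h_0 z ∈ Sel_∞` are distinct (`h_0` is injective,
`ker h_0 = H¹(Γ, E(K_∞)[p^∞]) = 0`, n1011's `Additive.layerToInfty_injective_of_no_pTorsion`),
`p`-torsion, and fixed by `conj_γ` for every `γ ∈ Γ_K` (`im h_0 ⊆ H¹(K_∞, E[p^∞])^Γ`, tree
`range_layerToInfty_le_layerInvariants_holds` with `κ.layerSubgroup 0 = ⊤`), so §1 applies.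
[cite: GreenbergLNM1716, §1 p. 60, Thm. 1.2 and §3 pp. 85–86 (Lemma 3.1)] -/
theorem card_le_natCard_quotient_maximalIdeal_of_layerZeroClasses [W.IsElliptic]
    [Module.Finite (IwasawaAlgebra p) D.X] (hK : ∀ P : W.toAffine.Point, p • P = 0 → P = 0)
    (t : Finset {z : W.selmerInftyPreimage κ 0 // p • z = 0}) :
    t.card ≤ Nat.card (D.X ⧸ maximalIdeal (IwasawaAlgebra p) •
      (⊤ : Submodule (IwasawaAlgebra p) D.X)) := by
  -- `g z = h_0 z` as an element of `Sel_∞` (`z ∈ A_0 = h_0⁻¹(Sel_∞)` by definition)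
  let g : {z : W.selmerInftyPreimage κ 0 // p • z = 0} → W.selmerInfty κ :=
    fun z ↦ ⟨W.layerToInfty κ 0 (z.1 : W.subgroupH1 p (κ.layerSubgroup 0)), z.1.2⟩
  have hg_coe : ∀ z, ((g z : W.selmerInfty κ) : W.subgroupH1 p κ.kerSubgroup) =
      W.layerToInfty κ 0 (z.1 : W.subgroupH1 p (κ.layerSubgroup 0)) := fun _ ↦ rfl
  -- injective (`E(K)[p] = 0`)
  have hg : Function.Injective g := by
    intro z z' h
    have h' := congrArg (fun s : W.selmerInfty κ ↦ (s : W.subgroupH1 p κ.kerSubgroup)) h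
    simp only [hg_coe] at h'
    exact Subtype.ext (Subtype.ext (Additive.layerToInfty_injective_of_no_pTorsion W κ hK 0 h'))
  rw [← Finset.card_map ⟨g, hg⟩]
  refine card_le_natCard_quotient_maximalIdeal D _ fun s hs ↦ ?_
  obtain ⟨z, -, rfl⟩ := Finset.mem_map.mp hs
  refine ⟨?_, ?_⟩
  · -- `p`-torsion
    apply Subtype.ext
    have hz : ((p • z.1 : W.selmerInftyPreimage κ 0) : W.subgroupH1 p (κ.layerSubgroup 0)) = 0 := by
      rw [z.2]; rfl
    change p • W.layerToInfty κ 0 (z.1 : W.subgroupH1 p (κ.layerSubgroup 0)) = 0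
    rw [← map_nsmul, ← AddSubgroup.coe_nsmul, hz, map_zero]
  · -- `Γ`-fixed
    have hmem : W.layerToInfty κ 0 (z.1 : W.subgroupH1 p (κ.layerSubgroup 0)) ∈
        W.layerInvariants κ 0 :=
      W.range_layerToInfty_le_layerInvariants_holds κ 0 ⟨_, rfl⟩
    rw [mem_layerInvariants_iff] at hmem
    exact hmem γ (by rw [ZpExtension.layerSubgroup_zero]; exact Subgroup.mem_top γ)

end LayerZero

end Summit.BirchSwinnertonDyer.Rank1Residual.X1.GeneratorCountLayerZero

end
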